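import Summits.KontsevichZagierPeriods.KontsevichZagierPeriods.Theorems.SoloInformedDomCalculus
import HarnessLib

/-!
# The sector maps of the corner step

Solo programme `solo-KontsevichZagierPeriods-informed`, session s111, PRES-RAT(2) step (γ)-5.

The corner step of the vertex recursion cuts the corner cell `[0, κ]²` into **sectors**
`S(κ, t, λ) = {0 < z₀ < κ, z₁ / z₀ strictly between t and t + λ}` and transports each sector to
the open unit square by the **sector map**

`Φ_{κ,t,λ}(x₀, x₁) = (κ x₀, κ x₀ (t + λ x₁))`,

an injective polynomial map with Jacobian `κ² λ x₀`.  Along `Φ` a `K`-polynomial `G` of corner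
multiplicity `m` pulls back to `(κ x₀)^m · child_{t,κ,λ}(G)` (`soloInformedChildK`), which is how
the children of the vertex recursion arise (file `SoloInformedSectorPullback`).

This file provides the map-level facts: derivative, determinant, injectivity, the image of the
open square, `ℚ`-semialgebraicity for parameters in `K ⊆ ℚ̄ ∩ ℝ` (including the general lemma
that `{x ∈ s | Ψ(x) ∈ Ω}` is `ℚ`-semialgebraic for a `K`-polynomial map `Ψ`), nullity of rays
through the corner, and the instance of Kontsevich–Zagier rule (2) along `Φ`:

`PresOn {x ∈ (0,1)² | Φ x ∈ Ω} ((f ∘ Φ) · κ²|λ| x₀) → PresOn (Ω ∩ S(κ,t,λ)) f`.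

References: Kontsevich–Zagier, *Periods* (2001) §1.2 rule (2); Bochnak–Coste–Roy, *Real algebraic
geometry* (1998) §2.2 [cite: BochnakCosteRoy1998, §2.2].
-/

open scoped BigOperators Topology
open MeasureTheory Set Filter Metric
open Literature.NumberTheory.Transcendental Literature.NumberTheory.Transcendental.KZ
open Literature.ModelTheory.ExponentialFields (IsSemialgebraic)

namespace Summit.KontsevichZagierPeriods.KontsevichZagierPeriods.Theorems

variable {K : Type*} [Field K] [Algebra K ℝ]

/-! ### Preimages under `K`-polynomial maps -/

/-- A `ℚ`-polynomial expression in the components of a `K`-polynomial map is a `ℚ`-semialgebraic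
function (for `K ⊆ ℚ̄ ∩ ℝ`). -/
theorem soloInformed_isSemialgebraicFunOn_aeval_comp {n n' : ℕ}
    (hK : ∀ c : K, IsAlgebraic ℚ (algebraMap K ℝ c)) {s : Set (Fin n → ℝ)}
    (hs : IsSemialgebraic ℚ s) (Ψ : Fin n' → MvPolynomial (Fin n) K)
    (p : MvPolynomial (Fin n') ℚ) :
    IsSemialgebraicFunOn ℚ s
      (fun x => (MvPolynomial.aeval (fun j => (MvPolynomial.aeval x (Ψ j) : ℝ)) p : ℝ)) := by
  induction p using MvPolynomial.induction_on with
  | C a =>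
    exact (isSemialgebraicFunOn_const_of_isAlgebraic hs (isAlgebraic_algebraMap a)).congr
      fun x _ => by simp
  | add p q hp hq => exact (hp.add_holds hq).congr fun x _ => by simp
  | mul_X p j hp =>
    exact (hp.fun_mul (soloInformed_isSemialgebraicFunOn_aevalK hK hs (Ψ j))).congr
      fun x _ => by simp

/-- **Preimages under `K`-polynomial maps.**  For a `ℚ`-semialgebraic `Ω` and a polynomial map
`Ψ` with coefficients in `K ⊆ ℚ̄ ∩ ℝ`, the set `{x ∈ s | Ψ x ∈ Ω}` is `ℚ`-semialgebraic
(induction over the Boolean algebra generated by the basic sets; graph elimination for the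
`ℚ`-semialgebraic functions `q ∘ Ψ`). -/
theorem soloInformed_isSemialgebraic_sep_preimage {n n' : ℕ}
    (hK : ∀ c : K, IsAlgebraic ℚ (algebraMap K ℝ c)) {s : Set (Fin n → ℝ)}
    (hs : IsSemialgebraic ℚ s) (Ψ : Fin n' → MvPolynomial (Fin n) K) {Ω : Set (Fin n' → ℝ)}
    (hΩ : IsSemialgebraic ℚ Ω) :
    IsSemialgebraic ℚ
      {x | x ∈ s ∧ (fun j => (MvPolynomial.aeval x (Ψ j) : ℝ)) ∈ Ω} := by
  induction hΩ using BooleanSubalgebra.closure_bot_sup_induction with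
  | mem t ht =>
    rcases ht with ⟨p, rfl⟩ | ⟨p, rfl⟩
    · have hf := soloInformed_isSemialgebraicFunOn_aeval_comp hK hs Ψ p
      convert hf.isSemialgebraic_sep_nonneg.inter hf.neg.isSemialgebraic_sep_nonneg using 1
      ext x
      simp only [mem_setOf_eq, mem_inter_iff, Pi.neg_apply, neg_nonneg]
      constructor
      · rintro ⟨hx, h⟩
        exact ⟨⟨hx, h.ge⟩, hx, h.le⟩
      · rintro ⟨⟨hx, h⟩, _, h'⟩
        exact ⟨hx, le_antisymm h' h⟩
    · convert (soloInformed_isSemialgebraicFunOn_aeval_comp hK hs Ψ p).neg.isSemialgebraic_sep_neg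
        using 1
      ext x
      simp
  | bot =>
    convert Literature.ModelTheory.ExponentialFields.isSemialgebraic_empty (k := ℚ)
      (ι := Fin n) (R := ℝ) using 1
    ext x
    simp
  | sup t _ u _ iht ihu =>
    convert iht.union ihu using 1
    ext x
    simp only [mem_setOf_eq, mem_union]
    constructor
    · rintro ⟨hx, h | h⟩
      · exact Or.inl ⟨hx, h⟩
      · exact Or.inr ⟨hx, h⟩
    · rintro (⟨hx, h⟩ | ⟨hx, h⟩)
      · exact ⟨hx, Or.inl h⟩
      · exact ⟨hx, Or.inr h⟩
  | compl t _ iht =>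
    convert hs.diff iht using 1
    ext x
    simp only [mem_setOf_eq, mem_compl_iff, Set.mem_sdiff]
    tauto

/-! ### Rays through the corner are null -/

/-- The line `{z₁ = h z₀}` through the corner is Lebesgue-null. -/
theorem soloInformed_volume_ray (h : ℝ) : volume {z : Fin 2 → ℝ | z 1 = h * z 0} = 0 := by
  let f : (Fin 2 → ℝ) →ₗ[ℝ] ℝ := LinearMap.proj 1 - h • LinearMap.proj 0
  have hS : {z : Fin 2 → ℝ | z 1 = h * z 0} = (LinearMap.ker f : Set (Fin 2 → ℝ)) := by
    ext z
    simp [f, sub_eq_zero]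
  rw [hS]
  refine Measure.addHaar_submodule volume _ fun htop => ?_
  have hmem : (fun i => if i = (1 : Fin 2) then (1 : ℝ) else 0) ∈ LinearMap.ker f := by
    rw [htop]; trivial
  simp [f] at hmem

/-! ### The sector map -/

/-- **The sector map** `Φ_{κ,t,λ}(x₀, x₁) = (κ x₀, κ x₀ (t + λ x₁))`. -/
def soloInformedSectorMap (κ t lam : ℝ) (x : Fin 2 → ℝ) : Fin 2 → ℝ :=
  ![κ * x 0, κ * x 0 * (t + lam * x 1)]

/-- First component of the sector map. -/
@[simp] theorem soloInformedSectorMap_apply_zero (κ t lam : ℝ) (x : Fin 2 → ℝ) :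
    soloInformedSectorMap κ t lam x 0 = κ * x 0 := rfl

/-- Second component of the sector map. -/
@[simp] theorem soloInformedSectorMap_apply_one (κ t lam : ℝ) (x : Fin 2 → ℝ) :
    soloInformedSectorMap κ t lam x 1 = κ * x 0 * (t + lam * x 1) := rfl

/-- The Jacobian matrix of the sector map. -/
noncomputable def soloInformedSectorDeriv (κ t lam : ℝ) (x : Fin 2 → ℝ) :
    (Fin 2 → ℝ) →L[ℝ] (Fin 2 → ℝ) :=
  LinearMap.toContinuousLinearMap
    (Matrix.toLin' !![κ, 0; κ * (t + lam * x 1), κ * x 0 * lam])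

/-- The Jacobian applied to a vector. -/
theorem soloInformedSectorDeriv_apply (κ t lam : ℝ) (x v : Fin 2 → ℝ) :
    soloInformedSectorDeriv κ t lam x v =
      ![κ * v 0, κ * (t + lam * x 1) * v 0 + κ * x 0 * lam * v 1] := by
  funext i
  fin_cases i <;>
    simp [soloInformedSectorDeriv, Matrix.toLin'_apply, Matrix.mulVec, dotProduct, Fin.sum_univ_two]

/-- **The Jacobian determinant is `κ² λ x₀`.** -/
theorem soloInformed_det_sectorDeriv (κ t lam : ℝ) (x : Fin 2 → ℝ) :
    (soloInformedSectorDeriv κ t lam x).det = κ ^ 2 * lam * x 0 := by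
  simp only [soloInformedSectorDeriv, ContinuousLinearMap.det, LinearMap.coe_toContinuousLinearMap,
    LinearMap.det_toLin', Matrix.det_fin_two_of]
  ring

/-- **Differentiability of the sector map** with the stated Jacobian. -/
theorem soloInformed_hasFDerivAt_sectorMap (κ t lam : ℝ) (x : Fin 2 → ℝ) :
    HasFDerivAt (soloInformedSectorMap κ t lam) (soloInformedSectorDeriv κ t lam x) x := by
  have h0 : HasFDerivAt (fun x : Fin 2 → ℝ => x 0)
      (ContinuousLinearMap.proj (R := ℝ) (φ := fun _ : Fin 2 => ℝ) 0) x :=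
    hasFDerivAt_apply (𝕜 := ℝ) 0 x
  have h1 : HasFDerivAt (fun x : Fin 2 → ℝ => x 1)
      (ContinuousLinearMap.proj (R := ℝ) (φ := fun _ : Fin 2 => ℝ) 1) x :=
    hasFDerivAt_apply (𝕜 := ℝ) 1 x
  have ha := h0.const_mul κ
  have hb := (h1.const_mul lam).const_add t
  have hab := ha.fun_mul hb
  refine hasFDerivAt_pi'' fun i => ?_
  fin_cases i
  · refine ha.congr_fderiv ?_
    ext v
    simp [soloInformedSectorDeriv_apply]
  · refine hab.congr_fderiv ?_
    ext v
    simp [soloInformedSectorDeriv_apply]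
    ring

/-- **Injectivity** of the sector map off the exceptional edge `x₀ = 0`. -/
theorem soloInformed_injOn_sectorMap {κ lam : ℝ} (hκ : κ ≠ 0) (hlam : lam ≠ 0) (t : ℝ) :
    InjOn (soloInformedSectorMap κ t lam) {x | x 0 ≠ 0} := by
  intro x hx y _ hxy
  have e0 := congr_fun hxy 0
  have e1 := congr_fun hxy 1
  simp only [soloInformedSectorMap_apply_zero, soloInformedSectorMap_apply_one] at e0 e1
  have hx0 : x 0 = y 0 := mul_left_cancel₀ hκ e0
  rw [← hx0] at e1
  have e2 : t + lam * x 1 = t + lam * y 1 := mul_left_cancel₀ (mul_ne_zero hκ hx) e1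
  have hx1 : x 1 = y 1 := mul_left_cancel₀ hlam (by linarith)
  funext i
  fin_cases i
  · exact hx0
  · exact hx1

/-! ### Sectors -/

/-- **The sector** `S(κ, t, λ)`: `0 < z₀ < κ` and `(z₁ − t z₀)/(λ z₀) ∈ (0, 1)`, i.e. the slope
`z₁ / z₀` lies strictly between `t` and `t + λ`. -/
def soloInformedSector (κ t lam : ℝ) : Set (Fin 2 → ℝ) :=
  {z | 0 < z 0 ∧ z 0 < κ ∧ 0 < (z 1 - t * z 0) / (lam * z 0) ∧ (z 1 - t * z 0) / (lam * z 0) < 1}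

/-- **The sector is the image of the open square** under the sector map. -/
theorem soloInformed_sectorMap_image {κ lam : ℝ} (hκ : 0 < κ) (hlam : lam ≠ 0) (t : ℝ) :
    soloInformedSectorMap κ t lam '' soloInformedOpenCube 2 = soloInformedSector κ t lam := by
  ext z
  constructor
  · rintro ⟨x, hx, rfl⟩
    have hx0 := hx 0
    have hx1 := hx 1
    have hκx : 0 < κ * x 0 := mul_pos hκ hx0.1
    have hx0' : x 0 ≠ 0 := hx0.1.ne'
    have hq : (κ * x 0 * (t + lam * x 1) - t * (κ * x 0)) / (lam * (κ * x 0)) = x 1 := by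
      field_simp
      ring
    refine ⟨hκx, ?_, ?_, ?_⟩
    · calc κ * x 0 < κ * 1 := mul_lt_mul_of_pos_left hx0.2 hκ
        _ = κ := mul_one κ
    · rw [soloInformedSectorMap_apply_zero, soloInformedSectorMap_apply_one, hq]; exact hx1.1
    · rw [soloInformedSectorMap_apply_zero, soloInformedSectorMap_apply_one, hq]; exact hx1.2
  · rintro ⟨h0, hκ', hq0, hq1⟩
    refine ⟨![z 0 / κ, (z 1 - t * z 0) / (lam * z 0)], fun j => ?_, ?_⟩
    · fin_cases j
      · exact ⟨div_pos h0 hκ, (div_lt_one hκ).2 hκ'⟩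
      · exact ⟨hq0, hq1⟩
    · have h0' : z 0 ≠ 0 := h0.ne'
      have e0 : soloInformedSectorMap κ t lam ![z 0 / κ, (z 1 - t * z 0) / (lam * z 0)] 0 =
          z 0 := by
        simp only [soloInformedSectorMap_apply_zero, Matrix.cons_val_zero]
        field_simp
      have e1 : soloInformedSectorMap κ t lam ![z 0 / κ, (z 1 - t * z 0) / (lam * z 0)] 1 =
          z 1 := by
        simp only [soloInformedSectorMap_apply_one, Matrix.cons_val_zero, Matrix.cons_val_one]
        field_simp
        ring
      funext i
      fin_cases i
      exacts [e0, e1]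

/-- The sector lies in the strip `0 < z₀ < κ`; in particular off the edge `z₀ = 0`. -/
theorem soloInformed_sector_fst {κ t lam : ℝ} {z : Fin 2 → ℝ} (hz : z ∈ soloInformedSector κ t lam) :
    0 < z 0 ∧ z 0 < κ := ⟨hz.1, hz.2.1⟩

/-! ### Semialgebraicity (parameters in `K`) -/

/-- The sector map with parameters in `K` as a vector of `K`-polynomials. -/
noncomputable def soloInformedSectorPolyK (κ t lam : K) : Fin 2 → MvPolynomial (Fin 2) K :=
  ![MvPolynomial.C κ * MvPolynomial.X 0,
    MvPolynomial.C κ * MvPolynomial.X 0 * (MvPolynomial.C t + MvPolynomial.C lam * MvPolynomial.X 1)]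

/-- The polynomial vector evaluates to the sector map. -/
theorem soloInformed_aeval_sectorPolyK (κ t lam : K) (x : Fin 2 → ℝ) (j : Fin 2) :
    (MvPolynomial.aeval x (soloInformedSectorPolyK κ t lam j) : ℝ) =
      soloInformedSectorMap (algebraMap K ℝ κ) (algebraMap K ℝ t) (algebraMap K ℝ lam) x j := by
  fin_cases j <;> simp [soloInformedSectorPolyK, soloInformedSectorMap]

/-- The sector map as the evaluation of its polynomial vector. -/
theorem soloInformed_sectorMap_eq_aeval (κ t lam : K) (x : Fin 2 → ℝ) :
    soloInformedSectorMap (algebraMap K ℝ κ) (algebraMap K ℝ t) (algebraMap K ℝ lam) x =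
      fun j => (MvPolynomial.aeval x (soloInformedSectorPolyK κ t lam j) : ℝ) :=
  funext fun j => (soloInformed_aeval_sectorPolyK κ t lam x j).symm

/-- The sector map with parameters in `K ⊆ ℚ̄ ∩ ℝ` is a `ℚ`-semialgebraic map on every
`ℚ`-semialgebraic set. -/
theorem soloInformed_isSemialgebraicMapOn_sectorMap
    (hK : ∀ c : K, IsAlgebraic ℚ (algebraMap K ℝ c)) {s : Set (Fin 2 → ℝ)}
    (hs : IsSemialgebraic ℚ s) (κ t lam : K) :
    IsSemialgebraicMapOn ℚ s
      (soloInformedSectorMap (algebraMap K ℝ κ) (algebraMap K ℝ t) (algebraMap K ℝ lam)) :=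
  IsSemialgebraicMapOn.of_forall hs fun j =>
    (soloInformed_isSemialgebraicFunOn_aevalK hK hs (soloInformedSectorPolyK κ t lam j)).congr
      fun x _ => soloInformed_aeval_sectorPolyK κ t lam x j

/-- `{x ∈ s | Φ x ∈ Ω}` is `ℚ`-semialgebraic for the sector map with parameters in `K`. -/
theorem soloInformed_isSemialgebraic_sep_sectorMap_mem
    (hK : ∀ c : K, IsAlgebraic ℚ (algebraMap K ℝ c)) {s : Set (Fin 2 → ℝ)}
    (hs : IsSemialgebraic ℚ s) (κ t lam : K) {Ω : Set (Fin 2 → ℝ)} (hΩ : IsSemialgebraic ℚ Ω) :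
    IsSemialgebraic ℚ {x | x ∈ s ∧
      soloInformedSectorMap (algebraMap K ℝ κ) (algebraMap K ℝ t) (algebraMap K ℝ lam) x ∈ Ω} := by
  convert soloInformed_isSemialgebraic_sep_preimage hK hs (soloInformedSectorPolyK κ t lam) hΩ
    using 1
  ext x
  rw [mem_setOf_eq, mem_setOf_eq, soloInformed_sectorMap_eq_aeval]

/-- The sector with parameters in `K ⊆ ℚ̄ ∩ ℝ` is `ℚ`-semialgebraic. -/
theorem soloInformed_isSemialgebraic_sector (hK : ∀ c : K, IsAlgebraic ℚ (algebraMap K ℝ c))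
    (κ t lam : K) :
    IsSemialgebraic ℚ
      (soloInformedSector (algebraMap K ℝ κ) (algebraMap K ℝ t) (algebraMap K ℝ lam)) := by
  have hu : IsSemialgebraic ℚ (univ : Set (Fin 2 → ℝ)) :=
    Literature.ModelTheory.ExponentialFields.isSemialgebraic_univ
  have hq := soloInformed_isSemialgebraicFunOn_aevalK_div₀ hK hu
    (MvPolynomial.X 1 - MvPolynomial.C t * MvPolynomial.X 0 : MvPolynomial (Fin 2) K)
    (MvPolynomial.C lam * MvPolynomial.X 0)
  have e1 : IsSemialgebraic ℚ {x : Fin 2 → ℝ | x ∈ univ ∧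
      (MvPolynomial.aeval x (-MvPolynomial.X 0 : MvPolynomial (Fin 2) K) : ℝ) < 0} :=
    (soloInformed_isSemialgebraicFunOn_aevalK hK hu _).isSemialgebraic_sep_neg
  have e2 : IsSemialgebraic ℚ {x : Fin 2 → ℝ | x ∈ univ ∧
      (MvPolynomial.aeval x (MvPolynomial.X 0 - MvPolynomial.C κ : MvPolynomial (Fin 2) K) : ℝ)
        < 0} :=
    (soloInformed_isSemialgebraicFunOn_aevalK hK hu _).isSemialgebraic_sep_neg
  have e3 := hq.neg.isSemialgebraic_sep_neg
  have e4 := (hq.sub_holds (isSemialgebraicFunOn_const_of_isAlgebraic hu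
    (isAlgebraic_algebraMap (1 : ℚ)))).isSemialgebraic_sep_neg
  convert ((e1.inter e2).inter e3).inter e4 using 1
  ext z
  simp only [soloInformedSector, mem_setOf_eq, mem_inter_iff, mem_univ, true_and, map_neg,
    MvPolynomial.aeval_X, map_sub, map_mul, MvPolynomial.aeval_C,
    Pi.neg_apply, Pi.sub_apply, neg_lt_zero, sub_lt_zero, eq_ratCast, Rat.cast_one]
  tauto

/-- On sets off the edge `x₀ ≤ 0`, the Jacobian factor `|det Φ'| = κ² |λ| x₀` is a
`ℚ`-semialgebraic function. -/
theorem soloInformed_isSemialgebraicFunOn_abs_det_sectorDeriv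
    (hK : ∀ c : K, IsAlgebraic ℚ (algebraMap K ℝ c)) {s : Set (Fin 2 → ℝ)}
    (hs : IsSemialgebraic ℚ s) (hs0 : ∀ x ∈ s, 0 < x 0) (κ t lam : K) :
    IsSemialgebraicFunOn ℚ s fun x =>
      |(soloInformedSectorDeriv (algebraMap K ℝ κ) (algebraMap K ℝ t) (algebraMap K ℝ lam) x).det|
      := by
  rcases le_or_gt 0 (algebraMap K ℝ lam) with hl | hl
  · refine (soloInformed_isSemialgebraicFunOn_aevalK hK hs
      (MvPolynomial.C (κ ^ 2 * lam) * MvPolynomial.X 0)).congr fun x hx => ?_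
    rw [soloInformed_det_sectorDeriv, abs_of_nonneg (mul_nonneg (mul_nonneg (sq_nonneg _) hl)
      (hs0 x hx).le)]
    simp
  · refine (soloInformed_isSemialgebraicFunOn_aevalK hK hs
      (MvPolynomial.C (-(κ ^ 2 * lam)) * MvPolynomial.X 0)).congr fun x hx => ?_
    rw [soloInformed_det_sectorDeriv, abs_of_nonpos (mul_nonpos_of_nonpos_of_nonneg
      (mul_nonpos_of_nonneg_of_nonpos (sq_nonneg _) hl.le) (hs0 x hx).le)]
    simp

/-! ### Rule (2) along the sector map -/

/-- **Transport to a sector.**  If `(f ∘ Φ) · κ² |λ| x₀` is presentable on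
`{x ∈ (0,1)² | Φ x ∈ Ω}`, then `f` is presentable on `Ω ∩ S(κ, t, λ)`
(Kontsevich–Zagier rule (2) along the injective polynomial map `Φ_{κ,t,λ}`). -/
theorem soloInformed_presOn_inter_sector (hK : ∀ c : K, IsAlgebraic ℚ (algebraMap K ℝ c))
    {κ t lam : K} (hκ : 0 < algebraMap K ℝ κ) (hlam : algebraMap K ℝ lam ≠ 0)
    {Ω : Set (Fin 2 → ℝ)} (hΩ : IsSemialgebraic ℚ Ω) {f : (Fin 2 → ℝ) → ℝ}
    (h : SoloInformedPresOn {x | x ∈ soloInformedOpenCube 2 ∧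
        soloInformedSectorMap (algebraMap K ℝ κ) (algebraMap K ℝ t) (algebraMap K ℝ lam) x ∈ Ω}
      fun x => f (soloInformedSectorMap (algebraMap K ℝ κ) (algebraMap K ℝ t)
        (algebraMap K ℝ lam) x) * (algebraMap K ℝ κ ^ 2 * |algebraMap K ℝ lam| * x 0)) :
    SoloInformedPresOn
      (Ω ∩ soloInformedSector (algebraMap K ℝ κ) (algebraMap K ℝ t) (algebraMap K ℝ lam)) f := by
  set Φ := soloInformedSectorMap (algebraMap K ℝ κ) (algebraMap K ℝ t) (algebraMap K ℝ lam)
    with hΦ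
  set S := {x | x ∈ soloInformedOpenCube 2 ∧ Φ x ∈ Ω} with hSdef
  have hS : IsSemialgebraic ℚ S :=
    soloInformed_isSemialgebraic_sep_sectorMap_mem hK (isSemialgebraic_soloInformedOpenCube 2) κ t lam
      hΩ
  have hS0 : ∀ x ∈ S, 0 < x 0 := fun x hx => (hx.1 0).1
  have himg : Φ '' S = Ω ∩ soloInformedSector (algebraMap K ℝ κ) (algebraMap K ℝ t)
      (algebraMap K ℝ lam) := by
    rw [← soloInformed_sectorMap_image hκ hlam]
    ext z
    constructor
    · rintro ⟨x, hx, rfl⟩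
      exact ⟨hx.2, mem_image_of_mem _ hx.1⟩
    · rintro ⟨hz, x, hx, rfl⟩
      exact ⟨x, ⟨hx, hz⟩, rfl⟩
  rw [← himg]
  refine soloInformed_presOn_image hS Φ
    (soloInformedSectorDeriv (algebraMap K ℝ κ) (algebraMap K ℝ t) (algebraMap K ℝ lam))
    (soloInformed_isSemialgebraicMapOn_sectorMap hK hS κ t lam)
    (fun x _ => (soloInformed_hasFDerivAt_sectorMap _ _ _ x).hasFDerivWithinAt)
    ((soloInformed_injOn_sectorMap hκ.ne' hlam _).mono fun x hx => (hS0 x hx).ne')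
    (soloInformed_isSemialgebraicFunOn_abs_det_sectorDeriv hK hS hS0 κ t lam) ?_
  refine (soloInformed_presOn_congr fun x hx => ?_).1 h
  rw [soloInformed_det_sectorDeriv, abs_mul, abs_mul, abs_of_nonneg (sq_nonneg (algebraMap K ℝ κ)),
    abs_of_pos (hS0 x hx)]

end Summit.KontsevichZagierPeriods.KontsevichZagierPeriods.Theorems
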